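import Summits.Ventures.HodgeRepro2.T5SU11ImproperEnergyIdentity
import Summits.Ventures.HodgeRepro2.T5SU11ResolventWeightedBasis

/-!
# An `L²(sinh 2t dt)` bound of the resolvent on the exponentially decaying class: `‖G^I_λ g‖ ≤ ‖g‖/μ`

For `λ > 2` and a source `g` of the class at a rate `ε > 1`, the energy identity of row 527,
`‖u′‖² + μ ‖u‖² = −⟨g, u⟩` for `u = G^I_λ g`, with the pointwise inequality `|g u| ≤ g²/(2μ) + μ u²/2` gives
`μ ‖u‖² ≤ ‖g‖²/(2μ) + μ ‖u‖²/2`, i.e.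

**`∫_{(0,∞)} sinh 2t · (G^I_λ g)² ≤ (∫_{(0,∞)} sinh 2t · g²)/μ²`** (`integral_sinh_mul_greenSolI_sq_le`)

— the resolvent is bounded on the class in the norm of `L²((0,∞), sinh 2t dt)` with the constant `1/μ = 1/(λ(λ−2))`
(row 478's sharp constant `1/(λ−1)²` on compactly supported sources needs the Hardy inequality on the class, not
built). Also `integrableOn_sinh_mul_sq` — `sinh 2t · g²` is integrable for a source of rate `ε > 1`. Nothing is
claimed about (N).

Blind lane: Mathlib + the HodgeRepro2 prefix only; no sorry; axioms ⊆ {propext, Classical.choice,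
Quot.sound}.
-/

namespace Summit.Ventures.HodgeRepro2.T5SU11ImproperL2Bound

open Filter Topology MeasureTheory
open Set (Ioi Ioc)
open T5SU11Cartan T5SU11SphericalFunction T5SU11SphericalDecay T5SU11RadialGreenImproper
  T5SU11RadialGreenImproperDecaySource T5SU11ResolventWeightedBasis T5SU11ImproperDerivativeIdentity
  T5SU11ImproperEnergyBracket T5SU11ImproperEnergyIdentity

section measure

variable [MeasurableSpace Circle] [BorelSpace Circle]

variable {lam : ℝ} (hlam : 1 < lam) {g : ℝ → ℝ} (hg : ContinuousOn g (Ioi 0))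
  {M : ℝ} (hM : ∀ s ∈ Ioc (0 : ℝ) 1, |g s| ≤ M) (hM0 : 0 ≤ M)
  {ε C s₀ : ℝ} (hε : 2 - lam < ε) (hC : ∀ s, s₀ ≤ s → |g s| ≤ C * Real.exp (-ε * s))
  (h2 : 2 < lam) (hε1 : 1 < ε)

omit [MeasurableSpace Circle] [BorelSpace Circle] in
include hg hM hC hε1 in
/-- `sinh 2t · g²` is integrable on `(0, ∞)` for a source of the class at a rate `ε > 1`. -/
theorem integrableOn_sinh_mul_sq : IntegrableOn (fun t => Real.sinh (2 * t) * g t ^ 2) (Ioi 0) := by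
  have hC0 : 0 ≤ C := by
    have hb0 := hC (max s₀ 0) (le_max_left _ _)
    have := abs_nonneg (g (max s₀ 0))
    have := Real.exp_pos (-ε * max s₀ 0)
    nlinarith
  have hcont : ContinuousOn (fun t => Real.sinh (2 * t) * g t ^ 2) (Ioi 0) :=
    (Real.continuous_sinh.comp (continuous_const.mul continuous_id)).continuousOn.mul (hg.pow 2)
  refine integrableOn_Ioi_of_bounded_of_decay hcont (B := Real.sinh 2 * M ^ 2) ?_ (K := C ^ 2 / 2) (T := max s₀ 0)
    (κ := 2 * ε - 2) (by linarith) ?_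
  · filter_upwards [Ioo_mem_nhdsGT one_pos] with t ht
    have hsinh : 0 ≤ Real.sinh (2 * t) := Real.sinh_nonneg_iff.mpr (by linarith [ht.1])
    rw [abs_mul, abs_of_nonneg hsinh, abs_pow]
    exact mul_le_mul (Real.sinh_le_sinh.mpr (by linarith [ht.2])) (pow_le_pow_left₀ (abs_nonneg _) (hM t ⟨ht.1, ht.2.le⟩) 2)
      (by positivity) (Real.sinh_pos_iff.mpr two_pos).le
  · intro t ht
    have ht0 : 0 ≤ t := le_trans (le_max_right _ _) ht
    have hsinh : 0 ≤ Real.sinh (2 * t) := Real.sinh_nonneg_iff.mpr (by linarith)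
    rw [abs_mul, abs_of_nonneg hsinh, abs_pow]
    calc Real.sinh (2 * t) * |g t| ^ 2 ≤ Real.exp (2 * t) / 2 * (C * Real.exp (-ε * t)) ^ 2 :=
          mul_le_mul (sinh_le_exp_div_two _) (pow_le_pow_left₀ (abs_nonneg _) (hC t (le_trans (le_max_left _ _) ht)) 2)
            (by positivity) (by positivity)
      _ = C ^ 2 / 2 * (Real.exp (2 * t) * (Real.exp (-ε * t) * Real.exp (-ε * t))) := by ring
      _ = C ^ 2 / 2 * Real.exp (-(2 * ε - 2) * t) := by
          rw [← Real.exp_add, ← Real.exp_add]; congr 2; ring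

include hlam hg hM hM0 hε hC h2 hε1 in
/-- **THE `L²` BOUND OF THE RESOLVENT ON THE CLASS**: `∫_{(0,∞)} sinh 2t (G^I_λ g)² ≤ (∫_{(0,∞)} sinh 2t g²)/μ²` for
`λ > 2` and a source of rate `ε > 1`. -/
theorem integral_sinh_mul_greenSolI_sq_le :
    ∫ t in Ioi 0, Real.sinh (2 * t) * greenSolI (fun t => sph lam (hyp t)) (sphDecay lam) g t ^ 2
      ≤ (∫ t in Ioi 0, Real.sinh (2 * t) * g t ^ 2) / (lam * (lam - 2)) ^ 2 := by
  set u := greenSolI (fun t => sph lam (hyp t)) (sphDecay lam) g with hu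
  have hμ : 0 < lam * (lam - 2) := mul_pos (by linarith) (by linarith)
  have hE := energy_identity_class hlam hg hM hM0 hε hC h2 hε1
  have hI1 := integrableOn_sinh_mul_greenSolI'_sq hlam hg hM hM0 hε hC h2 hε1
  have hI2 := integrableOn_sinh_mul_greenSolI_sq hlam hg hM hM0 hε hC h2 hε1
  have hI3 := integrableOn_sinh_mul_mul_greenSolI hlam hg hM hM0 hε hC hε1
  have hIg := integrableOn_sinh_mul_sq hg hM hC hε1
  set A := ∫ t in Ioi 0, Real.sinh (2 * t) * greenSolI' (deriv fun t => sph lam (hyp t)) (sphDecay' lam)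
    (fun t => sph lam (hyp t)) (sphDecay lam) g t ^ 2 with hA
  set B := ∫ t in Ioi 0, Real.sinh (2 * t) * u t ^ 2 with hB
  set G := ∫ t in Ioi 0, Real.sinh (2 * t) * g t ^ 2 with hG
  have hA0 : 0 ≤ A := by
    apply setIntegral_nonneg measurableSet_Ioi
    intro t ht
    have ht0 : 0 < t := ht
    exact mul_nonneg (Real.sinh_nonneg_iff.mpr (by linarith)) (sq_nonneg _)
  have hB0 : 0 ≤ B := by
    apply setIntegral_nonneg measurableSet_Ioi
    intro t ht
    have ht0 : 0 < t := ht
    exact mul_nonneg (Real.sinh_nonneg_iff.mpr (by linarith)) (sq_nonneg _)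
  -- `|⟨g, u⟩| ≤ G/(2μ) + μ B/2`
  have hcs : |∫ t in Ioi 0, Real.sinh (2 * t) * (g t * u t)| ≤ G / (2 * (lam * (lam - 2))) + lam * (lam - 2) / 2 * B := by
    have hIdom : IntegrableOn (fun t => Real.sinh (2 * t) * g t ^ 2 / (2 * (lam * (lam - 2)))
        + lam * (lam - 2) / 2 * (Real.sinh (2 * t) * u t ^ 2)) (Ioi 0) :=
      (hIg.div_const _).add (hI2.const_mul _)
    calc |∫ t in Ioi 0, Real.sinh (2 * t) * (g t * u t)|
        ≤ ∫ t in Ioi 0, |Real.sinh (2 * t) * (g t * u t)| := by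
          have := norm_integral_le_integral_norm (μ := volume.restrict (Ioi 0))
            (fun t => Real.sinh (2 * t) * (g t * u t))
          simpa only [Real.norm_eq_abs] using this
      _ ≤ ∫ t in Ioi 0, (Real.sinh (2 * t) * g t ^ 2 / (2 * (lam * (lam - 2)))
          + lam * (lam - 2) / 2 * (Real.sinh (2 * t) * u t ^ 2)) := by
          apply setIntegral_mono_on hI3.abs hIdom measurableSet_Ioi
          intro t ht
          have ht0 : 0 < t := ht
          have hsinh : 0 ≤ Real.sinh (2 * t) := Real.sinh_nonneg_iff.mpr (by linarith)
          rw [abs_mul, abs_of_nonneg hsinh, abs_mul]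
          have hamgm : |g t| * |u t| ≤ g t ^ 2 / (2 * (lam * (lam - 2))) + lam * (lam - 2) / 2 * u t ^ 2 := by
            have hsq := sq_nonneg (|g t| - lam * (lam - 2) * |u t|)
            have e1 : |g t| ^ 2 = g t ^ 2 := sq_abs _
            have e2 : |u t| ^ 2 = u t ^ 2 := sq_abs _
            have h2' : 2 * (lam * (lam - 2)) * (|g t| * |u t|) ≤ g t ^ 2 + (lam * (lam - 2)) ^ 2 * u t ^ 2 := by
              nlinarith [hsq, e1, e2]
            rw [show g t ^ 2 / (2 * (lam * (lam - 2))) + lam * (lam - 2) / 2 * u t ^ 2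
              = (g t ^ 2 + (lam * (lam - 2)) ^ 2 * u t ^ 2) / (2 * (lam * (lam - 2))) by
              field_simp]
            rw [le_div_iff₀ (by positivity)]
            linarith
          calc Real.sinh (2 * t) * (|g t| * |u t|)
              ≤ Real.sinh (2 * t) * (g t ^ 2 / (2 * (lam * (lam - 2))) + lam * (lam - 2) / 2 * u t ^ 2) :=
                mul_le_mul_of_nonneg_left hamgm hsinh
            _ = Real.sinh (2 * t) * g t ^ 2 / (2 * (lam * (lam - 2))) + lam * (lam - 2) / 2 * (Real.sinh (2 * t) * u t ^ 2) := by
                ring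
      _ = G / (2 * (lam * (lam - 2))) + lam * (lam - 2) / 2 * B := by
          rw [integral_add (hIg.div_const _) (hI2.const_mul _), MeasureTheory.integral_div,
            MeasureTheory.integral_const_mul]
  -- `μ B ≤ −⟨g, u⟩ ≤ |⟨g, u⟩|`
  have hμB : lam * (lam - 2) * B ≤ |∫ t in Ioi 0, Real.sinh (2 * t) * (g t * u t)| := by
    have := neg_le_abs (∫ t in Ioi 0, Real.sinh (2 * t) * (g t * u t))
    linarith
  have hkey : lam * (lam - 2) / 2 * B ≤ G / (2 * (lam * (lam - 2))) := by linarith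
  rw [le_div_iff₀ (by positivity)]
  have := mul_le_mul_of_nonneg_left hkey (by positivity : 0 ≤ 2 * (lam * (lam - 2)))
  have hl : lam ≠ 0 := by linarith
  have hl2 : lam - 2 ≠ 0 := by linarith
  calc B * (lam * (lam - 2)) ^ 2 = 2 * (lam * (lam - 2)) * (lam * (lam - 2) / 2 * B) := by ring
    _ ≤ 2 * (lam * (lam - 2)) * (G / (2 * (lam * (lam - 2)))) := this
    _ = G := by field_simp

end measure

end Summit.Ventures.HodgeRepro2.T5SU11ImproperL2Bound
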